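import Literature.MathematicalPhysics.QuantumFieldTheory.Balaban1983to89.B10Assembly

/-!
# `Balaban1983to89.B10Eq66UpperForm` — T. Bałaban, *Ultraviolet stability of three-dimensional lattice pure gauge
field theories*, Commun. Math. Phys. **102** (1985) 255–275 [Balaban1985UV3], Sect. D p. 273, the display **(66)**:
«We obtain a bound of the form (41) with the expression −(1/g_k²)A^η(U_k) + Σ_{j=0}^{k−1} O(log g_j⁻¹)|Z_j| +
O(1)|T₁^{(k)}| (66) in the exponential.» — TYPED as a named statement on the carrier of record (`B10.TowerRun`) and
PROVED as the printed inference (41) + «(44)–(46)» + (64)–(65) ⇒ (66), one run and the whole family (with the O(1)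
DISPLAYED), together with its printed use «(66) + the large-field small factors ⇒ the upper bound in (5)» (p. 274)

statement-level skeleton of published theorems with citation tags; proofs where landed; nothing here is a claim about
the Yang–Mills mass gap

SOURCES (HELD; read on the ×2 renders `run/shared/lean/pub/pub-balaban/b2b-balaban-ref1/pages/1985-cmp102-uv-stability-
3d/…-p018-x2.png` (journal p. 272) and `…-p019-x2.png` (p. 273), PDF `paper:balaban1985-cmp102-uv-stability-3d`,
journal page = PDF page + 254).
* p. 272, Sect. D opening: «D. Concluding Remarks. We have to show that the inequalities (41), (47) imply Theorem 1,
  i.e. the inequalities (5). Let us consider the upper bound (41). We estimate the interaction terms using the bounds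
  (44)–(46) by O(1)M₁³g²_{k−1}p²(g_{k−1})|Λ_k| ≤ O(1)|T₁^{(k)}|. The constant E_k is given by the sum E_k =
  Σ_{j=k}^{K−1} E^{(j)}, (64) where E^{(j)} is defined by (62). From (25), which holds for arbitrary j, we get easily
  |E^{(j)}| ≤ O(1)|T₁^{(j)}|, hence |E_k| ≤ Σ_{k=k}^{K−1} ⟦sic: j = k⟧ O(1)|T₁^{(j)}| = Σ_{j=k}^{K−1} O(1)L^{−3(j−k)}|T₁^{(k)}|
  ≤ O(1)|T₁^{(k)}|. (65) We obtain a bound of the form (41) with the expression −(1/g_k²)A^η(U_k) + Σ_{j=0}^{k−1}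
  O(log g_j⁻¹)|Z_j| + O(1)|T₁^{(k)}| (66) in the exponential.»
* p. 266, (41) (the inductive assumption): «ρ_k(V) ≤ Σ_{{Ω_j}} ∫dV_{k−1}↾_{Z_{k−1}} δ(V̄_{k−1}V⁻¹) ⋯ ∫dV₀↾_{Z₀}
  δ(V̄₀V₁⁻¹) χ_kζ_{Λ_{k−1}}χ_{k−1} ⋯ ζ_{Λ₁}χ₁ζ_{Ω₁ᶜ} exp[−(1/g_k²)A^η(U_k) + Σ_{j=1}^kΣ_{Y_j}𝒫_j(Y_j, U_k) − E_k +
  Σ_{j=0}^{k−1}O(log g_j⁻¹)|Z_j| + Σ_{j=0}^{k−1}O((L^jε)^{3+κ₀})|T₁^{(j)}|]» — the cell՚s `B10.Ineq41`.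
* pp. 273–274, after (71): «The analysis of Sect. 3.C [9], which is model independent, show that these small factors
  are enough to control all sums in (41), together with the second term in (65) ⟦sic: (66)⟧. This gives the upper
  bound in (5). The lower bound is simpler, it is enough to use (44)–(46) and (66) ⟦sic: (65)⟧.»

CITATION HEADER (lean-in-tree rule).  WHAT IS REPRODUCED: row `B10.Eq66` of SKELETON block B10 (`HOME/lit-balaban-
r07/ROWS-B10.md` §1; head `typed-existing`, note «proved (from leaves)»: the display had NO declaration of its own —
the cell՚s `B10.upper5_of_41` (unit b2b-balaban-r2) passes THROUGH (66) inside its proof (its `step2`) on the way from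
(41) to the upper half of (5), and `B10Assembly.bounds5_of_leafSystem` does the same for the family).  Unit
`lit-balaban-r07` (fold owner of B10), gen 53, free target under G.5-34(d).  THIS FILE names the display (`Ineq66`,
a predicate with body over the carrier of record, §1), proves it from (41) and the three Sect. D piece bounds exactly
as the paragraph says (§1), factors the cell՚s (41) ⇒ (5) through it (§2), and derives it for every run of a family
carrying `B10Assembly.LeafSystem`s with the O(1) DISPLAYED — on a coupling window (`c66 = aI + bW + cR`, so that the
O(1) of (5) is `O1 = c66 + d`, §3) and window-free with the `log g_k` dependence explicit (`bLog`, §3; cell GAPS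
G-B10-01: the second term of (62) makes print՚s «O(1)» of (65)/(66) an `a + a′|log g_k|`).  Imports `B10Assembly`
ONLY (hence `B10`, `B10LargeField`, `B10SectAGathering`); nothing edited; NO new cited fact (`Ineq66`, `c66`, `bLog` are
definitions with bodies; every theorem is proved here); axioms standard.

DICTIONARY (the cell՚s, `B10.TowerRun` docstring): `T.ρ k U` ↦ ρ_k(V); `T.LF k U F` ↦ the large-field sum ∕ history
integral of (41) «Σ_{{Ω_j}} ∫dV_{k−1}↾ ⋯ χ_kζ_{Λ_{k−1}} ⋯ ζ_{Ω₁ᶜ}» applied to `exp ∘ F` (monotone in `F`, `LF(F + t) =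
eᵗLF(F)`); `T.mainT k h U` ↦ (1/g_k²)A^η(U_k); `T.Pint k h U` ↦ Σ_{j=1}^kΣ_{Y_j}𝒫_j(Y_j, U_k); `T.Ecst k` ↦ E_k;
`T.Zterm k h` ↦ Σ_{j=0}^{k−1}O(log g_j⁻¹)|Z_j|; `T.Rm k` ↦ Σ_{j=0}^{k−1}O((L^jε)^{3+κ₀})|T₁^{(j)}|; `T.sites k` ↦ |T₁^{(k)}|.

WHAT THIS FILE PROVES (kernel, 0 sorry; no `Prop`-fact).
* §1 `Ineq66 T c k` — (66) typed: `ρ_k(V) ≤ LF_k(V)[−(1/g_k²)A^η(U_k) + Σ_{j<k}O(log g_j⁻¹)|Z_j| + c·|T₁^{(k)}|]` with ONE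
  real `c` («O(1)»); `exponent41_le_exponent66` (the arithmetic of the paragraph: interaction ≤ a|T|, |E_k| ≤ b|T|,
  remainder ≤ c|T| ⇒ the (41)-exponent ≤ the (66)-exponent with O(1) = a + b + c, history by history);
  **`ineq66_of_41`** ((41) + the three piece bounds ⇒ (66), by the monotonicity of the history functional);
  `ineq66_mono` (a larger O(1) is allowed).
* §2 **`upper5_of_66`** (p. 274: (66) + the large-field control `LF_k(V)[−(1/g_k²)A^η(U_k) + Σ O(log g_j⁻¹)|Z_j|] ≤
  e^{d|T₁^{(k)}|}` — the cell՚s leaf shape `B10.LargeFieldControlPrinted` ∕ `LeafSystem.lf` — ⇒ `ρ_k ≤ e^{(c+d)|T₁^{(k)}|}`,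
  the upper half of (5)); `upper5_of_41_via_66` (the cell՚s `B10.upper5_of_41` re-obtained as the composite of the two
  printed sentences); `bounds5At_of_66_47` ((66) ∧ (47) + the piece bounds ⇒ (5) at step k with O(1) = a + b + c + d —
  cf. `B10.bounds5At_of_ineqs`, which starts from (41)).
* §3 family level over `B10Assembly.Consts` ∕ `LeafSystem`: `c66 C gmin gmax := aI C + bW C gmin gmax + cR C` and
  `O1_eq_c66_add_d` (the displayed O(1) of (5), `B10Assembly.O1`, IS (66)՚s constant plus the large-field `d`);
  **`ineq66_of_leafSystem`** ((66) at every step k ≤ K whose coupling lies in a window [gmin, gmax] ⊂ (0, ∞), for every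
  run of the family, ONE constant `c66`: Theorem 2 (`thm2_of_leafSystem`) gives (41)_k, Sect. D՚s `pint_abs_le` ∕
  `LeafSystem.ecst_abs_le` ∕ `LeafSystem.Rm_le` give the piece bounds); `bLog C x` and `ecst_abs_le_log`
  (|E_k| ≤ bLog(g_k)|T₁^{(k)}| — `B10.Ecst_abs_le` on the leaf system, no window), **`ineq66_of_leafSystem_log`** ((66) at
  EVERY k ≤ K with the constant `aI + bLog(g_k) + cR`, the honest form of print՚s O(1)); `bLog_le_bW` (on a window the
  log form is below the window constant) and `ineq66_of_leafSystem'` (§3՚s window statement re-derived through the log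
  form); `upper5_of_leafSystem_via_66` (the upper half of (5) with `O1` through (66) — the same inequality as
  `(bounds5_of_leafSystem …).2`).
* §4 non-vacuity: `ineq66_trivRun_zero` ((66) with O(1) = 0 on the cell՚s trivial run `B10Assembly.trivRun K`, directly)
  and `ineq66_trivRun` (§3՚s log form applied to the inhabited leaf system `trivLeafSystem K` — the hypotheses of
  `ineq66_of_leafSystem_log` are jointly satisfiable).

HONEST SCOPE.  (i) CARRIER: (66), like (41) and (47), is typed over the cell՚s ABSTRACT tower carrier `B10.TowerRun`,
whose fields only NAME the printed functionals (densities, the history functional, the composite minimizer՚s action,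
interaction, counterterm, Z-terms, remainder); nothing is constructed from the Wilson action — exactly the status of
rows B10.Eq41 ∕ Eq47 ∕ Eq5.  (ii) WHAT IS PROVED is the printed INFERENCE of the Sect. D paragraph, from (41) and the
three piece bounds as hypotheses (§1–§2), resp. from the leaf system (§3) — i.e. modulo the located leaves of
`B10Assembly` (LEAF CENSUS there): (46), the inputs of (65), the remainder rates, Theorem 2՚s step leaves; the
large-field control enters only §2՚s `upper5_of_66` and only as the cell՚s leaf shape.  (iii) PRINT՚S «O(1)» in (66):
by (62) p. 271 E^{(k)} contains d(𝔤) log g_k|T₁^{(k)*}|, so the constant is a + a′|log g_k| (cell GAPS G-B10-01,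
`B10.Estep62_abs_le`); §3 states both the window form (ONE constant for g_k in a compact window, the reading under which
Theorem 1 is assembled, `B10.Thm1PrintedCompact`) and the log-explicit form; neither is asserted for g_k → 0 with one
constant.  (iv) The remainder term Σ_{j<k}O((L^jε)^{3+κ₀})|T₁^{(j)}| of (41) is not mentioned by the p. 273 sentence; it is
absorbed into O(1)|T₁^{(k)}| by `B10.remainderSum_le` ∕ `LeafSystem.Rm_le` (L^kε ≤ 1), as in the cell՚s assembly.
(v) `≤` for print՚s `≤`; nothing about d = 4; NOT Theorem 1 beyond what `B10Assembly` already certifies (the same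
inequalities, now routed through the named display).
-/

namespace Literature.MathematicalPhysics.QuantumFieldTheory.Balaban1983to89.B10Eq66UpperForm

open Literature.MathematicalPhysics.QuantumFieldTheory.Balaban1983to89
open Literature.MathematicalPhysics.QuantumFieldTheory.Balaban1983to89.B10
open Literature.MathematicalPhysics.QuantumFieldTheory.Balaban1983to89.B10Assembly

noncomputable section

/-! ## 1. The display (66) on the carrier of record, and (41) ⇒ (66) -/

/-- **(66)** p. 273 [19], verbatim: «We obtain a bound of the form (41) with the expression −(1/g_k²)A^η(U_k) +
Σ_{j=0}^{k−1} O(log g_j⁻¹)|Z_j| + O(1)|T₁^{(k)}| (66) in the exponential.» — typed over the carrier `B10.TowerRun` of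
(41)/(47): the density is bounded by the SAME large-field sum ∕ history integral `LF_k` as in (41)
(«a bound of the form (41)»), applied to the exponential of `−(1/g_k²)A^η(U_k) + Σ_{j<k}O(log g_j⁻¹)|Z_j| + c|T₁^{(k)}|`,
with ONE real constant `c` (print՚s «O(1)»; HONEST SCOPE (iii)). [cite: Balaban1985UV3, (66) p.273] -/
def Ineq66 (T : TowerRun) (c : ℝ) (k : ℕ) : Prop :=
  ∀ U : T.Cfg k, T.ρ k U ≤ T.LF k U (fun h => -(T.mainT k h U) + T.Zterm k h + c * T.sites k)

/-- `Ineq66` unfolded (definitional). [cite: Balaban1985UV3, (66) p.273] -/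
theorem ineq66_iff (T : TowerRun) (c : ℝ) (k : ℕ) :
    Ineq66 T c k ↔
      ∀ U : T.Cfg k, T.ρ k U ≤ T.LF k U (fun h => -(T.mainT k h U) + T.Zterm k h + c * T.sites k) :=
  Iff.rfl

/-- THE ARITHMETIC OF THE PARAGRAPH (p. 272 l. −2 to p. 273 (66)): if the interaction terms are `≤ a|T₁^{(k)}|` in
absolute value («We estimate the interaction terms using the bounds (44)–(46) by O(1)M₁³g²_{k−1}p²(g_{k−1})|Λ_k| ≤
O(1)|T₁^{(k)}|»), `|E_k| ≤ b|T₁^{(k)}|` ((65)) and the remainder sum of (41) is `≤ c|T₁^{(k)}|` (HONEST SCOPE (iv)), then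
for every large-field history the exponent of (41) is at most the expression (66) with O(1) = a + b + c.
Kernel-checked linear arithmetic. [cite: Balaban1985UV3, (65)–(66) p.273] -/
theorem exponent41_le_exponent66 (T : TowerRun) (k : ℕ) {a b c : ℝ} (h : T.Hist k) (U : T.Cfg k)
    (hP : |T.Pint k h U| ≤ a * T.sites k) (hE : |T.Ecst k| ≤ b * T.sites k) (hR : T.Rm k ≤ c * T.sites k) :
    -(T.mainT k h U) + T.Pint k h U - T.Ecst k + T.Zterm k h + T.Rm k
      ≤ -(T.mainT k h U) + T.Zterm k h + (a + b + c) * T.sites k := by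
  have h1 := (abs_le.mp hP).2
  have h2 := (abs_le.mp hE).1
  linarith

/-- **(41) ⇒ (66)** (Sect. D pp. 272–273): the inductive bound (41) at step k together with the three piece bounds —
interaction `≤ a|T₁^{(k)}|` for every history, `|E_k| ≤ b|T₁^{(k)}|` ((64)–(65)), remainder `≤ c|T₁^{(k)}|` — gives (66) with
O(1) = a + b + c, by the monotonicity of the history functional in the exponent.  Re-derived bookkeeping,
kernel-checked. [cite: Balaban1985UV3, (41) p.266 + (66) p.273] -/
theorem ineq66_of_41 (T : TowerRun) (k : ℕ) {a b c : ℝ} (h41 : Ineq41 T k)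
    (hP : ∀ (h : T.Hist k) (U : T.Cfg k), |T.Pint k h U| ≤ a * T.sites k)
    (hE : |T.Ecst k| ≤ b * T.sites k) (hR : T.Rm k ≤ c * T.sites k) :
    Ineq66 T (a + b + c) k := fun U =>
  (h41 U).trans (T.lf_mono k U _ _ fun h => exponent41_le_exponent66 T k h U (hP h U) hE hR)

/-- A larger O(1) is allowed in (66) (monotonicity of the history functional, |T₁^{(k)}| ≥ 0) — an elementary
property of the printed display, no content of the series. [cite: Balaban1985UV3, (66) p.273] -/
theorem ineq66_mono (T : TowerRun) (k : ℕ) {c c' : ℝ} (hcc : c ≤ c') (h66 : Ineq66 T c k) : Ineq66 T c' k :=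
  fun U => (h66 U).trans (T.lf_mono k U _ _ fun h => by
    have := mul_le_mul_of_nonneg_right hcc (T.sites_nonneg k)
    linarith)

/-! ## 2. The printed use of (66): with the large-field small factors it gives the upper bound in (5) -/

/-- **(66) ⇒ the upper half of (5)** (pp. 273–274 [19–20]: «these small factors are enough to control all sums in
(41), together with the second term in (65) ⟦(66)⟧. This gives the upper bound in (5).»): if (66) holds with constant
`c` and the large-field sum with the Z-terms is controlled, `LF_k(V)[−(1/g_k²)A^η(U_k) + Σ_{j<k}O(log g_j⁻¹)|Z_j|] ≤
e^{d|T₁^{(k)}|}` (the cell՚s leaf shape `B10.LargeFieldControlPrinted`, (67)–(71) + [9] Sect. 3.C), then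
`ρ_k(V) ≤ e^{(c+d)|T₁^{(k)}|}`.  Re-derived bookkeeping (`LF(F + t) = eᵗLF(F)`), kernel-checked.
[cite: Balaban1985UV3, (66) p.273 + (5) p.256 + pp.273–274] -/
theorem upper5_of_66 (T : TowerRun) (k : ℕ) {c d : ℝ} (h66 : Ineq66 T c k)
    (hLF : ∀ U : T.Cfg k,
      T.LF k U (fun h => -(T.mainT k h U) + T.Zterm k h) ≤ Real.exp (d * T.sites k))
    (U : T.Cfg k) : T.ρ k U ≤ Real.exp ((c + d) * T.sites k) := by
  have h1 := h66 U
  rw [T.lf_shift] at h1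
  have h2 : Real.exp (c * T.sites k) * T.LF k U (fun h => -(T.mainT k h U) + T.Zterm k h)
      ≤ Real.exp (c * T.sites k) * Real.exp (d * T.sites k) :=
    mul_le_mul_of_nonneg_left (hLF U) (Real.exp_pos _).le
  rw [← Real.exp_add] at h2
  calc T.ρ k U ≤ _ := h1
    _ ≤ _ := h2
    _ = Real.exp ((c + d) * T.sites k) := by ring_nf

/-- The cell՚s `B10.upper5_of_41` ((41) + the four piece bounds ⇒ `ρ_k ≤ e^{(a+b+c+d)|T₁^{(k)}|}`) RE-OBTAINED as the
composite of the two printed sentences: (41) ⇒ (66) (`ineq66_of_41`), then (66) + large fields ⇒ (5) upper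
(`upper5_of_66`).  Same statement as `B10.upper5_of_41`; kernel-checked. [cite: Balaban1985UV3, Sect. D pp.272–274] -/
theorem upper5_of_41_via_66 (T : TowerRun) (k : ℕ) {a b c d : ℝ} (h41 : Ineq41 T k)
    (hP : ∀ (h : T.Hist k) (U : T.Cfg k), |T.Pint k h U| ≤ a * T.sites k)
    (hE : |T.Ecst k| ≤ b * T.sites k) (hR : T.Rm k ≤ c * T.sites k)
    (hLF : ∀ U : T.Cfg k,
      T.LF k U (fun h => -(T.mainT k h U) + T.Zterm k h) ≤ Real.exp (d * T.sites k))
    (U : T.Cfg k) : T.ρ k U ≤ Real.exp ((a + b + c + d) * T.sites k) :=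
  upper5_of_66 T k (ineq66_of_41 T k h41 hP hE hR) hLF U

/-- **(66) ∧ (47) ⇒ (5) at step k** with O(1) = a + b + c + d (d ≥ 0): the upper half through `upper5_of_66`, the lower
half by the cell՚s `B10.lower5_of_47` (p. 274: «The lower bound is simpler, it is enough to use (44)–(46) and (66)
⟦(65)⟧» — no large-field input on that side).  Compare `B10.bounds5At_of_ineqs`, which starts from (41).
Re-derived bookkeeping, kernel-checked. [cite: Balaban1985UV3, (5) p.256 + Sect. D pp.272–274] -/
theorem bounds5At_of_66_47 (T : TowerRun) (k : ℕ) {a b c d : ℝ} (hd : 0 ≤ d)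
    (h66 : Ineq66 T (a + b + c) k) (h47 : Ineq47 T k)
    (hP : ∀ U : T.Cfg k, |T.Pint k (T.triv k) U| ≤ a * T.sites k)
    (hE : |T.Ecst k| ≤ b * T.sites k) (hR : T.Rm k ≤ c * T.sites k)
    (hLF : ∀ U : T.Cfg k,
      T.LF k U (fun h => -(T.mainT k h U) + T.Zterm k h) ≤ Real.exp (d * T.sites k)) :
    Bounds5At T.toRunData (a + b + c + d) k := by
  intro U
  refine ⟨?_, upper5_of_66 T k h66 hLF U⟩
  refine le_trans ?_ (lower5_of_47 T k a b c h47 hP hE hR U)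
  apply mul_le_mul_of_nonneg_left _ (T.χ_nonneg k U)
  apply Real.exp_le_exp.mpr
  have := mul_nonneg hd (T.sites_nonneg k)
  show -((T.g k)⁻¹ ^ 2 * T.wilsonBG k U) - (a + b + c + d) * T.sites k
    ≤ -((T.g k)⁻¹ ^ 2 * T.wilsonBG k U) - (a + b + c) * T.sites k
  linarith

/-! ## 3. (66) for a family of runs carrying leaf systems, with the O(1) displayed -/

section Family

variable {C : Consts} {T : TowerRun}

/-- **The O(1) of (66) DISPLAYED** on a coupling window [gmin, gmax] ⊂ (0, ∞): `c66 = aI + bW(gmin, gmax) + cR` —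
interaction ((46) + Sect. D line 1, `B10Assembly.aI`), counterterm ((62)/(64)/(65) with the d(𝔤) log g_k term, the only
window dependence, `B10Assembly.bW`), remainder (`B10Assembly.cR`); independent of ε, of k and of the run.
[cite: Balaban1985UV3, (66) p.273 + Sect. D p.272] -/
def c66 (C : Consts) (gmin gmax : ℝ) : ℝ := aI C + bW C gmin gmax + cR C

/-- The displayed O(1) of (5) (`B10Assembly.O1 = aI + bW + cR + d`) IS (66)՚s constant plus the large-field constant
`d` of pp. 273–274 — the split «(66) … together with the small factors … gives the upper bound in (5)».
Definitional. [cite: Balaban1985UV3, (66) p.273 + (5) p.256] -/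
theorem O1_eq_c66_add_d (C : Consts) (gmin gmax : ℝ) : O1 C gmin gmax = c66 C gmin gmax + C.d := rfl

/-- **(66) FOR THE FAMILY, window form**: for runs `T i` each carrying a `LeafSystem C (T i)` (the located leaves of
[Balaban1985UV3] with common constants), at every step k ≤ K whose coupling g_k lies in [gmin, gmax] ⊂ (0, ∞),
(66) holds with the ONE constant `c66 C gmin gmax`: Theorem 2 (`B10Assembly.thm2_of_leafSystem`) supplies (41)_k,
Sect. D՚s three piece bounds are `B10Assembly.pint_abs_le` («(44)–(46) … ≤ O(1)|T₁^{(k)}|»),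
`LeafSystem.ecst_abs_le` ((64)–(65)) and `LeafSystem.Rm_le` (the remainder), and §1՚s `ineq66_of_41` concludes.
Re-derived bookkeeping, kernel-checked; every leaf a hypothesis (HONEST SCOPE (ii)).
[cite: Balaban1985UV3, (66) p.273 + Thm 2 p.272] -/
theorem ineq66_of_leafSystem {I : Type} (T : I → TowerRun) (S : ∀ i, LeafSystem C (T i))
    {gmin gmax : ℝ} (hmin : 0 < gmin) (i : I) (k : ℕ) (hk : k ≤ (T i).K)
    (h1 : gmin ≤ (T i).g k) (h2 : (T i).g k ≤ gmax) :
    Ineq66 (T i) (c66 C gmin gmax) k :=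
  ineq66_of_41 (T i) k (((S i).spec k).mp (thm2_of_leafSystem T S i k hk)).1
    (pint_abs_le T S i k hk) ((S i).ecst_abs_le hmin k h1 h2) ((S i).Rm_le k hk)

/-- The counterterm constant of (65) WITH THE LOG TERM EXPLICIT (no window): `bLog(x) = (a₁ + 3dg|log x|)/(1 − L⁻³) +
3dg(½ log L)L⁻³/(1 − L⁻³)²` — the coefficient of `B10.Ecst_abs_le` at the family constants (cell GAPS G-B10-01: the
term d(𝔤) log g_k|T₁^{(k)*}| of (62) p. 271). [cite: Balaban1985UV3, (62) p.271 + (65) p.273] -/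
def bLog (C : Consts) (x : ℝ) : ℝ :=
  (a₁ C + (3 * C.dg) * |Real.log x|) / (1 - (C.L ^ 3)⁻¹)
    + ((3 * C.dg) * (Real.log C.L / 2)) * ((C.L ^ 3)⁻¹ / (1 - (C.L ^ 3)⁻¹) ^ 2)

/-- (64)–(65) on a leaf system WITHOUT a window: `|E_k| ≤ bLog(g_k)|T₁^{(k)}|` for every k (the cell՚s `B10.Ecst_abs_le`
fed with the model scaling and the per-step bound `LeafSystem.estep_abs_le`).  Re-derived, kernel-checked.
[cite: Balaban1985UV3, (64)–(65) p.273] -/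
theorem ecst_abs_le_log (S : LeafSystem C T) (k : ℕ) :
    |T.Ecst k| ≤ bLog C (T.g k) * T.sites k :=
  Ecst_abs_le T C.g C.L S.ε S.Tε (a₁ C) (3 * C.dg) C.g_pos C.one_lt_L S.ε_pos S.Tε_nonneg
    (a₁_nonneg C) (by linarith [C.dg_nonneg]) S.g_eq S.sites_eq (fun j hj => S.estep_abs_le j hj) k

/-- **(66) FOR THE FAMILY, log-explicit form (the honest reading of print՚s O(1))**: at EVERY step k ≤ K of every run
carrying a leaf system, (66) holds with the constant `aI + bLog(g_k) + cR` — uniform in ε, k and the run except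
through `|log g_k|` (HONEST SCOPE (iii)).  Re-derived bookkeeping, kernel-checked.
[cite: Balaban1985UV3, (66) p.273 + (62) p.271] -/
theorem ineq66_of_leafSystem_log {I : Type} (T : I → TowerRun) (S : ∀ i, LeafSystem C (T i))
    (i : I) (k : ℕ) (hk : k ≤ (T i).K) :
    Ineq66 (T i) (aI C + bLog C ((T i).g k) + cR C) k :=
  ineq66_of_41 (T i) k (((S i).spec k).mp (thm2_of_leafSystem T S i k hk)).1
    (pint_abs_le T S i k hk) (ecst_abs_le_log (S i) k) ((S i).Rm_le k hk)

/-- On a window the log-explicit constant is below the window constant: `bLog(x) ≤ bW(gmin, gmax)` for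
`gmin ≤ x ≤ gmax`, `0 < gmin` (`B10.abs_log_le_of_mem`) — the step from the log-explicit (65) to its window form;
elementary, no content of the series. [cite: Balaban1985UV3, (65) p.273] -/
theorem bLog_le_bW (C : Consts) {gmin gmax x : ℝ} (hmin : 0 < gmin) (h1 : gmin ≤ x) (h2 : x ≤ gmax) :
    bLog C x ≤ bW C gmin gmax := by
  have hM := abs_log_le_of_mem gmin gmax x hmin h1 h2
  have hL : 1 < C.L := C.one_lt_L
  have hL0 : 0 < C.L := by linarith
  have hr1 : (C.L ^ 3)⁻¹ < 1 := inv_lt_one_of_one_lt₀ (one_lt_pow₀ hL (by norm_num))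
  have h1r : 0 < 1 - (C.L ^ 3)⁻¹ := by linarith
  have hdg : 0 ≤ 3 * C.dg := by linarith [C.dg_nonneg]
  unfold bLog bW
  have : (a₁ C + (3 * C.dg) * |Real.log x|) / (1 - (C.L ^ 3)⁻¹)
      ≤ (a₁ C + (3 * C.dg) * max |Real.log gmin| |Real.log gmax|) / (1 - (C.L ^ 3)⁻¹) :=
    div_le_div_of_nonneg_right (by nlinarith) h1r.le
  linarith

/-- §3՚s window statement re-derived THROUGH the log form: `ineq66_of_leafSystem_log` + `bLog_le_bW` + `ineq66_mono`.
Kernel-checked consistency of the two readings. [cite: Balaban1985UV3, (66) p.273] -/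
theorem ineq66_of_leafSystem' {I : Type} (T : I → TowerRun) (S : ∀ i, LeafSystem C (T i))
    {gmin gmax : ℝ} (hmin : 0 < gmin) (i : I) (k : ℕ) (hk : k ≤ (T i).K)
    (h1 : gmin ≤ (T i).g k) (h2 : (T i).g k ≤ gmax) :
    Ineq66 (T i) (c66 C gmin gmax) k :=
  ineq66_mono (T i) k (by have := bLog_le_bW C hmin h1 h2; unfold c66; linarith)
    (ineq66_of_leafSystem_log T S i k hk)

/-- **The upper half of (5) for the family THROUGH (66)**: `ρ_k(V) ≤ exp(O1(gmin, gmax)|T₁^{(k)}|)` at every step whose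
coupling lies in the window — `upper5_of_66` fed with `ineq66_of_leafSystem` and the large-field leaf `LeafSystem.lf`;
the same inequality as `(B10Assembly.bounds5_of_leafSystem …).2`, now routed through the named display.
Re-derived bookkeeping, kernel-checked. [cite: Balaban1985UV3, (5) p.256 + (66) p.273 + pp.273–274] -/
theorem upper5_of_leafSystem_via_66 {I : Type} (T : I → TowerRun) (S : ∀ i, LeafSystem C (T i))
    {gmin gmax : ℝ} (hmin : 0 < gmin) (i : I) (k : ℕ) (hk : k ≤ (T i).K)
    (h1 : gmin ≤ (T i).g k) (h2 : (T i).g k ≤ gmax) (U : (T i).Cfg k) :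
    (T i).ρ k U ≤ Real.exp (O1 C gmin gmax * (T i).sites k) := by
  rw [O1_eq_c66_add_d]
  exact upper5_of_66 (T i) k (ineq66_of_leafSystem T S hmin i k hk h1 h2) ((S i).lf k hk) U

end Family

/-! ## 4. Non-vacuity: (66) on the cell՚s trivial run -/

/-- On the trivial (empty-interaction) run of depth K (`B10Assembly.trivRun K`: ρ_k ≡ 1, all terms 0, LF = exp) the
display (66) holds at every k with O(1) = 0 — directly.  A NON-VACUITY INSTANCE of the typed display (consistency of
the typing, nothing about gauge theory). [cite: Balaban1985UV3, (66) p.273] -/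
theorem ineq66_trivRun_zero (K k : ℕ) : Ineq66 (trivRun K) 0 k := fun U => by
  show (1 : ℝ) ≤ Real.exp (-(0 : ℝ) + 0 + 0 * sitesRun 2 (((2 : ℝ) ^ K)⁻¹) 1 k)
  simp

/-- … and §3՚s log form applies to the inhabited leaf system `B10Assembly.trivLeafSystem K` (one-member family): the
hypotheses of `ineq66_of_leafSystem_log` are jointly satisfiable, so the family theorem is not vacuous.  A NON-VACUITY
INSTANCE of the typed display (consistency of the typing, nothing about gauge theory). [cite: Balaban1985UV3, (66) p.273] -/
theorem ineq66_trivRun (K k : ℕ) (hk : k ≤ K) :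
    Ineq66 (trivRun K) (aI trivConsts + bLog trivConsts ((trivRun K).g k) + cR trivConsts) k :=
  ineq66_of_leafSystem_log (fun _ : Unit => trivRun K) (fun _ => trivLeafSystem K) () k hk

end

end Literature.MathematicalPhysics.QuantumFieldTheory.Balaban1983to89.B10Eq66UpperForm
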